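import Literature.AlgebraicGeometry.HilbertScheme.NakajimaOperators
import HarnessLib

/-!
# The Chern character operators `𝔊ₖ(γ)` on `ℍ = ⨁ₙ H*(S^[n])`: cup products in Nakajima operators
(Lehn 1999; Li–Qin–Wang, Math. Ann. 2002 and IMRN 2002) — hypothesis structure and named facts

Layer `Literature/AlgebraicGeometry/HilbertScheme`; sequel of `NakajimaOperators`.  The RING structure of
`H*(S^[n])` is tied to the Heisenberg operators through the classes
`G_k(γ, n) ∈ H^{|γ|+2k}(S^[n])` (the `H^{|γ|+2k}`-component of `p₁*(ch(𝒪_{𝒵ₙ}) · p₂*td(S) · p₂*γ)`, `𝒵ₙ ⊂ S^[n] × S`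
the universal family) and the operators `𝔊ₖ(γ) = ⨁ₙ (G_k(γ, n) ∪ ·)`:

* Li–Qin–Wang, Math. Ann. 2002, Thm. 1.2 (= Thm. 5.30): for `n ≥ 1` the ring `H*(S^[n])` is generated by the
  `G_k(γ, n)`, `0 ≤ k < n`;
* Lehn's theorem in the form LQW Thm. 5.13 (iv) `𝔊₀(γ) = −𝔏₀(γ)` (cup product with `G₀(γ, n)`, e.g. with the divisor
  class `D_α = G₀(α, n)` of `α ∈ H²(S)`, is minus the Virasoro zero-mode `𝔏₀(γ) = Σ_{m>0} 𝔮ₘ𝔮₋ₘ τ₂*(γ)` — Oberdieck's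
  "`e_α = −Σ_{n>0} 𝔮ₙ𝔮₋ₙ(Δ_*α)`, by the results of Lehn"), recorded in the COMMUTATOR form it is proved and used in:
  `[𝔊₀(γ), 𝔮ₘ(β)] = m · 𝔮ₘ(γβ)` (5.13 (iv) with Thm. 2.16 (ii); conversely this determines `𝔊₀(γ)`, which kills the
  vacuum, by `NakajimaOperators.ext_of_commute`), together with (5.6) `G₀(1_S, n) = n · 1_{S^[n]}`;
* Lehn's boundary operator `𝔡 = 𝔊₁(1_S)` (cup product with `c₁(𝒪_S^[n]) = −½[∂S^[n]]`, Lehn Def. 3.8, LQW (5.7)) with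
  the canonical-class-free part of Lehn's Thm. 3.10: `[[𝔡, 𝔮ₙ(α)], 𝔮ₘ(β)] = −nm 𝔮_{n+m}(αβ)` for `n + m ≠ 0`
  (Prop. 3.12);
* for surfaces with `K_S = 0` and `e(S) = 0` — ABELIAN SURFACES, the case the Hodge ladder needs — Li–Qin–Wang,
  IMRN 2002, Thm. 4.6: `𝔊ₖ(α) = −Σ_{ℓ(λ)=k+2, |λ|=0} 𝔞_λ(τ_*α)/λ! + Σ_{ℓ(λ)=k, |λ|=0} (s(λ)−2)/(24λ!) 𝔞_λ(τ_*(eα))` for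
  `K_X α = 0`; with `K = 0`, `e = 0` the second sum vanishes and the first is minus the zero-mode `W₀^{k+2}(α)` of
  LQW Math. Ann. Def. 4.3, whose iterated commutators are LQW Math. Ann. Lemma 4.10 (i):
  `[⋯[𝔊ₖ(γ), 𝔮_{m₁}(α₁)], …, 𝔮_{m_{k+1}}(α_{k+1})] = −(−m₁)⋯(−m_{k+1}) · 𝔮_{m₁+⋯+m_{k+1}}(γα₁⋯α_{k+1})`.

## Sources (read; PDF pages of the materialised texts)

* Li–Qin–Wang, Math. Ann. 324 (2002) (arXiv:math/0009132): Thm. 1.2 p. 2; Def. 5.1 p. 12 ("`𝔊ᵢ(γ) = ⨁ₙ G_i(γ, n)`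
  where again `G_i(γ, n)` acts on `ℍₙ = H*(X^[n])` by the cup product … homogeneous of bi-degree `(0, |γ|+2i)`");
  (5.6) p. 12 ("`𝔊₀(1_X) = ⨁ₙ (n · Id_{X^[n]})`"), (5.7) ("`𝔊₁(1_X) = ⨁ₙ c₁(p₁*𝒪_{𝒵ₙ}) = 𝔡`"); Thm. 5.13 (iv)–(v)
  p. 13 ("`𝔊₀(γ) = −W₀²(γ)`"; "`𝔊₁(γ) = −W₀³(γ)` if `K_X` is numerically trivial") with (5.15)
  ("`[𝔊₀(γ), 𝔮ₙ(α)] = [𝔊₀(1_X), 𝔮ₙ(γα)] = [−𝔏₀(1_X), 𝔮ₙ(γα)]`"); Thm. 2.16 (ii) p. 5 ("`[𝔏ₙ(α), 𝔮ₘ(β)] =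
  −m · 𝔮_{n+m}(αβ)`"); Def. 4.3 p. 9 and Lemma 4.6 / Thm. 4.10 (i) p. 10 ("`[…[W^k_{n₀}(α₀), 𝔮_{n₁}(α₁)], …],
  𝔮_{n_{k−1}}(α_{k−1})]` is equal to `∏_{ℓ=1}^{k−1}(−n_ℓ) · 𝔮_{n₀+…+n_{k−1}}(α₀⋯α_{k−1})`"); Thm. 5.30 p. 14.
* Li–Qin–Wang, *Hilbert schemes and W algebras*, IMRN 2002 (arXiv:math/0111047): p. 6 (conventions:
  `𝔞₋ₙ(α)` = Nakajima's creation operator, i.e. `𝔞ₙ = 𝔮₋ₙ`; "`G(γ, 0) = 0`"; "`𝔡 = 𝔊₁(1_X)` … first introduced in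
  [Leh]"), Def. 4.1 p. 8 (`λ`, `ℓ(λ)`, `|λ|`, `s(λ)`, `λ!`, `𝔞_λ(τ_*α)`, `𝔄_X = {α | K_X α = 0}`), Thm. 4.6 p. 10
  (verbatim above).
* M. Lehn, Invent. Math. 136 (1999) (arXiv:math/9803091): Def. 3.8 p. 12 ("`𝔡(x) := c₁(𝒪_X^[n]) · x =
  −½[∂X^[n]] · x`"), Thm. 3.10 p. 12 ("`[𝔮ₙ′(α), 𝔮ₘ(β)] = −nm · {𝔮_{n+m}(αβ) + (|n|−1)/2 · δ_{n+m} · ∫_X Kαβ · id}`",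
  `𝔮ₙ′ = [𝔡, 𝔮ₙ]`), Prop. 3.12 p. 12 (the case `n + m ≠ 0`, free of the canonical class `K`).
* G. Oberdieck, Comment. Math. Helv. 96 (2021) (arXiv:1908.08830) p. 6: "By the results of Lehn and Maulik–Negut
  we have for all `α ∈ A¹(S)` the equality `e_α = −Σ_{n>0} 𝔮ₙ𝔮₋ₙ(Δ_*α)` … The formulas hold also in cohomology for all
  `α ∈ H²(S, ℚ)`."

## Rendering and design

* `ChernCharacterOperators hS H extends NakajimaOperators hS H` by the DATA `G k n : H*(S(ℂ)) →ₗ H*(S^[n](ℂ))`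
  (`γ ↦ G_k(γ, n)`, linear in `γ`) with: degree (`G_k` raises degree by `2k`), `G(γ, 0) = 0`, (5.6), the commutator
  form of 5.13 (iv), Lehn's Prop. 3.12 for `𝔡 = 𝔊₁(1_S)`, and ring generation (Thm. 1.2) phrased with
  `cupSubalgebra` (the smallest cup-closed submodule containing `1`, built on the tree's `Hyperkaehler.IsCupClosed`).
  The cup-product operator `cupOperator 𝔊 k γ = ⨁ₙ (G_k(γ, n) ∪ ·)` is `fiberwise` of the prequel with the tree's
  `totalCup`.  The classes `G_k(γ, n)` are NOT constructed (no Chern character of `𝒪_{𝒵ₙ}` in the tree): the axioms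
  are the printed properties; `𝔊₀` and `𝔡` are pinned by them (`ext_of_commute`), `G_k` for `k ≥ 2` only through the
  abelian-surface predicate below.
* `ChernCharacterOperators.IsVertexExpressible 𝔊` — the iterated-commutator identities of ALL `𝔊ₖ(γ)` above (the
  content of IMRN Thm. 4.6 when `K_S = 0` and `e(S) = 0`).  NAMED FACTS: `LiQinWang2002_chernCharacterOperators`
  (every smooth projective surface: an instance of `ChernCharacterOperators` exists — the Chern character classes
  with Nakajima's operators) and `LiQinWang2002W_chernCharacter_abelianSurface` (for an abelian surface an instance
  satisfying `IsVertexExpressible` exists).  EXISTENTIAL INTERFACE RENDERING as in the prequel.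
* SCOPE / TODO(general form): IMRN Thm. 4.6 for `α ⊥ K_X` with the Euler-class term, Thm. 4.7 for arbitrary `α`, and
  Lehn's `K_X`-term in Thm. 3.10 are not rendered (the tree has no canonical/Euler class of a surface in
  `complexBetti`); they are needed for no consumer of the Hodge ladder (abelian surfaces: `K = 0`, `e = 0`).

## Not here

The `W`-algebra relations (IMRN Thm. 5.5 ff.), Virasoro operators `𝔏ₙ`, `n ≠ 0`, Lehn's formulas for `c(L^[n])`;
the Lefschetz `𝔰𝔩₂` (sequel `LefschetzDualTransfer`).
-/

noncomputable section

open DirectSum CategoryTheory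
open Literature.AlgebraicTopology.SingularHomology
open Literature.AlgebraicGeometry.Motives (SchemeOver ComplexPoints IsSmoothProjective AbelianVariety)
open Literature.AlgebraicGeometry.Hyperkaehler (totalCohomology ofDegree totalCup IsCupClosed)
open Literature.AlgebraicGeometry.HodgeTheory (complexBetti)

namespace Literature.AlgebraicGeometry.HilbertScheme

/-! ### Cup-closed subalgebras of `H*(Y; R)` -/

section CupSubalgebra

universe u v

variable (R : Type v) [CommRing R] (Y : Type u) [TopologicalSpace Y]

/-- **The sub-`R`-algebra of `H*(Y; R)` generated by `G`**: the smallest submodule of the total cohomology containing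
`G` and the unit `1 ∈ H⁰(Y; R)` and closed under the tree's cup product `totalCup` ("the subring … generated by the
following cohomology classes"). [cite: LiQinWang2002, Def. 5.18 p. 13] -/
def cupSubalgebra (G : Set (totalCohomology R Y)) : Submodule R (totalCohomology R Y) :=
  sInf {W | G ⊆ W ∧ ofDegree R Y 0 (singularCohomology.one R Y) ∈ W ∧ IsCupClosed W}

variable {R Y}

/-- The generators lie in the subalgebra they generate. [cite: LiQinWang2002, Def. 5.18 p. 13] -/
theorem subset_cupSubalgebra (G : Set (totalCohomology R Y)) : G ⊆ cupSubalgebra R Y G := by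
  intro v hv
  simp only [cupSubalgebra, SetLike.mem_coe, Submodule.mem_sInf, Set.mem_setOf_eq]
  exact fun W hW ↦ hW.1 hv

/-- The unit lies in every generated subalgebra. [cite: LiQinWang2002, Def. 5.18 p. 13] -/
theorem one_mem_cupSubalgebra (G : Set (totalCohomology R Y)) :
    ofDegree R Y 0 (singularCohomology.one R Y) ∈ cupSubalgebra R Y G := by
  simp only [cupSubalgebra, Submodule.mem_sInf, Set.mem_setOf_eq]
  exact fun W hW ↦ hW.2.1

/-- A generated subalgebra is cup-closed. [cite: LiQinWang2002, Def. 5.18 p. 13] -/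
theorem isCupClosed_cupSubalgebra (G : Set (totalCohomology R Y)) : IsCupClosed (cupSubalgebra R Y G) := by
  intro x hx y hy
  simp only [cupSubalgebra, Submodule.mem_sInf, Set.mem_setOf_eq] at hx hy ⊢
  exact fun W hW ↦ hW.2.2 x (hx W hW) y (hy W hW)

/-- Minimality of the generated subalgebra. [cite: LiQinWang2002, Def. 5.18 p. 13] -/
theorem cupSubalgebra_le {G : Set (totalCohomology R Y)} {W : Submodule R (totalCohomology R Y)} (hG : G ⊆ W)
    (h1 : ofDegree R Y 0 (singularCohomology.one R Y) ∈ W) (hW : IsCupClosed W) : cupSubalgebra R Y G ≤ W :=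
  sInf_le ⟨hG, h1, hW⟩

end CupSubalgebra

/-! ### The Chern character operators: the hypothesis structure -/

variable {S : SchemeOver ℂ}

/-- **Nakajima operators together with the Chern character classes `G_k(γ, n) ∈ H^{|γ|+2k}(S^[n])`** of a smooth
projective surface (`G_k(γ, n)` = the `H^{|γ|+2k}`-component of `p₁*(ch 𝒪_{𝒵ₙ} · p₂*td S · p₂*γ)`; `𝔊ₖ(γ)` = cup product
with `G_k(γ, n)` on each `ℍₙ`), subject to the printed properties: `G_k` raises the degree by `2k` (Def. 5.1);
`G(γ, 0) = 0`; `G₀(1_S, n) = n · 1_{S^[n]}` (5.6); **`[𝔊₀(γ), 𝔮ₘ(β)] = m 𝔮ₘ(γβ)`** (Thm. 5.13 (iv) `𝔊₀(γ) = −𝔏₀(γ)`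
with Thm. 2.16 (ii) — Lehn's formula `e_α = −Σ 𝔮ₙ𝔮₋ₙ(Δ_*α)` for the divisor classes `G₀(α, n)`, `α ∈ H²(S)`);
**`[[𝔡, 𝔮ₙ(α)], 𝔮ₘ(β)] = −nm 𝔮_{n+m}(αβ)` for `n + m ≠ 0`**, `𝔡 = 𝔊₁(1_S)` Lehn's boundary operator (Lehn Thm. 3.10 /
Prop. 3.12, LQW (5.7)); and **`H*(S^[n])` is generated as an algebra by the `G_k(γ, n)`, `0 ≤ k < n`** (Thm. 1.2).
[cite: LiQinWang2002, Thm. 1.2, Def. 5.1, (5.6)–(5.7), Thm. 5.13 (iv) with (5.15) and Thm. 2.16 (ii), Thm. 5.30]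
[cite: Lehn1999, Def. 3.8, Thm. 3.10 and Prop. 3.12] [cite: LiQinWang2002W, §3 p. 6 (G(γ,0) = 0, 𝔡 = 𝔊₁(1_X))] -/
structure ChernCharacterOperators (hS : IsSmoothProjective 2 S) (H : HilbertSchemesOfPoints S)
    extends NakajimaOperators hS H where
  /-- `γ ↦ G_k(γ, n) ∈ H*(S^[n](ℂ); ℂ)`, linear in `γ ∈ H*(S(ℂ); ℂ)`. -/
  G : ℕ → (n : ℕ) → totalCohomology ℂ (ComplexPoints S) →ₗ[ℂ] totalCohomology ℂ (ComplexPoints (H.obj n))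
  /-- `G_k(γ, n) ∈ H^{|γ|+2k}(S^[n])` for `γ ∈ H^{|γ|}(S)`. -/
  G_degree : ∀ (k n s : ℕ) (γ : complexBetti S s),
    G k n (ofDegree ℂ (ComplexPoints S) s γ) ∈
      LinearMap.range (ofDegree ℂ (ComplexPoints (H.obj n)) (s + 2 * k))
  /-- `G(γ, 0) = 0`. -/
  G_at_zero : ∀ (k : ℕ) (γ : totalCohomology ℂ (ComplexPoints S)), G k 0 γ = 0
  /-- `G₀(1_S, n) = n · 1_{S^[n]}` (LQW (5.6)). -/
  G_zero_unit : ∀ n : ℕ, G 0 n (unitCoeff S) =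
    (n : ℂ) • ofDegree ℂ (ComplexPoints (H.obj n)) 0 (singularCohomology.one ℂ (ComplexPoints (H.obj n)))
  /-- `[𝔊₀(γ), 𝔮ₘ(β)] = m · 𝔮ₘ(γ ∪ β)` for homogeneous `γ ∈ Hˢ(S)`, `β ∈ Hʲ(S)` (super-bracket with parities `s`, `j`). -/
  G_zero_bracket : ∀ (s : ℕ) (γ : complexBetti S s) (m : ℤ) (j : ℕ) (β : complexBetti S j),
    superBracket ℂ (fiberwise ℂ (fockFamily H) fun n ↦ totalCup ℂ (ComplexPoints (H.obj n))
        (G 0 n (ofDegree ℂ (ComplexPoints S) s γ))) (q m (ofDegree ℂ (ComplexPoints S) j β)) s j =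
      (m : ℂ) • q m (totalCup ℂ (ComplexPoints S) (ofDegree ℂ (ComplexPoints S) s γ) (ofDegree ℂ (ComplexPoints S) j β))
  /-- Lehn's boundary operator `𝔡 = 𝔊₁(1_S)`: `[[𝔡, 𝔮ₙ(α)], 𝔮ₘ(β)] = −nm · 𝔮_{n+m}(α ∪ β)` for `n + m ≠ 0`. -/
  boundary_bracket : ∀ (n' m : ℤ), n' + m ≠ 0 → ∀ (i : ℕ) (α : complexBetti S i) (j : ℕ) (β : complexBetti S j),
    superBracket ℂ
        (superBracket ℂ (fiberwise ℂ (fockFamily H) fun n ↦ totalCup ℂ (ComplexPoints (H.obj n)) (G 1 n (unitCoeff S)))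
          (q n' (ofDegree ℂ (ComplexPoints S) i α)) 0 i)
        (q m (ofDegree ℂ (ComplexPoints S) j β)) i j =
      (-((n' : ℂ) * m)) •
        q (n' + m) (totalCup ℂ (ComplexPoints S) (ofDegree ℂ (ComplexPoints S) i α) (ofDegree ℂ (ComplexPoints S) j β))
  /-- Thm. 1.2: for `n ≥ 1`, `H*(S^[n])` is generated as an algebra by the `G_k(γ, n)`, `0 ≤ k < n`. -/
  generation : ∀ n : ℕ, 1 ≤ n →
    cupSubalgebra ℂ (ComplexPoints (H.obj n))
        {x | ∃ k : ℕ, k < n ∧ ∃ γ : totalCohomology ℂ (ComplexPoints S), x = G k n γ} = ⊤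

namespace ChernCharacterOperators

variable {hS : IsSmoothProjective 2 S} {H : HilbertSchemesOfPoints S}

/-- **The Chern character operator `𝔊ₖ(γ) = ⨁ₙ (G_k(γ, n) ∪ ·)`** on `ℍ`. [cite: LiQinWang2002, Def. 5.1 p. 12] -/
def cupOperator (𝔊 : ChernCharacterOperators hS H) (k : ℕ) (γ : totalCohomology ℂ (ComplexPoints S)) :
    Module.End ℂ (fockSpace H) :=
  fiberwise ℂ (fockFamily H) fun n ↦ totalCup ℂ (ComplexPoints (H.obj n)) (𝔊.G k n γ)

/-- **Lehn's boundary operator `𝔡 = 𝔊₁(1_S)`** (cup product with `c₁(𝒪_S^[n]) = −½[∂S^[n]]` on each `H*(S^[n])`).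
[cite: Lehn1999, Def. 3.8 p. 12] [cite: LiQinWang2002, (5.7) p. 12] -/
def boundaryOperator (𝔊 : ChernCharacterOperators hS H) : Module.End ℂ (fockSpace H) :=
  𝔊.cupOperator 1 (unitCoeff S)

/-- **The divisor class `D_α = G₀(α, n) ∈ H²(S^[n](ℂ); ℂ)` of a class `α ∈ H²(S(ℂ); ℂ)`** (the `H²`-component of
`G₀(α, n)`; by `G_degree` nothing is lost) — Oberdieck's `e_α` is cup product with it, Beauville's
`j : H²(S) → H²(S^[n])`. [cite: LiQinWang2002, Def. 5.1 p. 12] [cite: Oberdieck2021, §3.1 (e_α) p. 6] -/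
def divisorClass (𝔊 : ChernCharacterOperators hS H) (n : ℕ) (α : complexBetti S 2) : complexBetti (H.obj n) 2 :=
  component ℂ ℕ (fun k ↦ complexBetti (H.obj n) k) 2 (𝔊.G 0 n (ofDegree ℂ (ComplexPoints S) 2 α))

/-- `𝔊ₖ(γ)` acts on `ℍₙ` by cup product with `G_k(γ, n)`. [cite: LiQinWang2002, Def. 5.1 p. 12] -/
theorem cupOperator_apply_ofSummand (𝔊 : ChernCharacterOperators hS H) (k : ℕ)
    (γ : totalCohomology ℂ (ComplexPoints S)) (n : ℕ) (x : FockSummand (fockFamily H) n) :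
    𝔊.cupOperator k γ (Fock.ofSummand ℂ (fockFamily H) n x) =
      Fock.ofSummand ℂ (fockFamily H) n (totalCup ℂ (ComplexPoints (H.obj n)) (𝔊.G k n γ) x) :=
  fiberwise_apply_ofSummand _ n x

/-- `𝔊ₖ(γ)` is linear in `γ`. [cite: LiQinWang2002, Def. 5.1 p. 12] -/
theorem cupOperator_add (𝔊 : ChernCharacterOperators hS H) (k : ℕ) (γ γ' : totalCohomology ℂ (ComplexPoints S)) :
    𝔊.cupOperator k (γ + γ') = 𝔊.cupOperator k γ + 𝔊.cupOperator k γ' := by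
  refine DirectSum.linearMap_ext ℂ fun n ↦ LinearMap.ext fun x ↦ ?_
  simp [cupOperator, fiberwise, map_add]

/-- The divisor class recovers `G₀(α, n)`: `G₀(α, n) = D_α` placed in degree `2`. [cite: LiQinWang2002, Def. 5.1 p. 12] -/
theorem ofDegree_divisorClass (𝔊 : ChernCharacterOperators hS H) (n : ℕ) (α : complexBetti S 2) :
    ofDegree ℂ (ComplexPoints (H.obj n)) 2 (𝔊.divisorClass n α) = 𝔊.G 0 n (ofDegree ℂ (ComplexPoints S) 2 α) := by
  obtain ⟨d, hd⟩ := 𝔊.G_degree 0 n 2 α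
  have hd' : ofDegree ℂ (ComplexPoints (H.obj n)) 2 d = 𝔊.G 0 n (ofDegree ℂ (ComplexPoints S) 2 α) := hd
  rw [divisorClass, ← hd']
  exact congrArg _ (DirectSum.component.lof_self (M := fun k ↦ complexBetti (H.obj n) k) ℂ 2 d)

/-- `𝔊ₖ(γ)` kills the vacuum (`G(γ, 0) = 0`). [cite: LiQinWang2002W, §3 p. 6] -/
theorem cupOperator_vacuum (𝔊 : ChernCharacterOperators hS H) (k : ℕ) (γ : totalCohomology ℂ (ComplexPoints S)) :
    𝔊.cupOperator k γ (vacuumVector H) = 0 := by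
  rw [vacuumVector, Fock.of, LinearMap.comp_apply]
  erw [𝔊.cupOperator_apply_ofSummand k γ 0]
  rw [𝔊.G_at_zero, map_zero, LinearMap.zero_apply, map_zero]

/-- **The iterated-commutator identities of all `𝔊ₖ(γ)`** ("vertex expressibility"): for every `k ≥ 0`, homogeneous
`γ ∈ Hˢ(S)` and modes/classes `(m₁, α₁), …, (m_{k+1}, α_{k+1})`,
`[⋯[𝔊ₖ(γ), 𝔮_{m₁}(α₁)], …, 𝔮_{m_{k+1}}(α_{k+1})] = −(−m₁)⋯(−m_{k+1}) · 𝔮_{m₁+⋯+m_{k+1}}(γ α₁ ⋯ α_{k+1})` — i.e.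
`𝔊ₖ(γ) = −W₀^{k+2}(γ)`, the zero-mode of the normally ordered `(k+2)`-point vertex operator (LQW Math. Ann.
Lemma 4.10 (i)), which is Li–Qin–Wang's IMRN Thm. 4.6 `𝔊ₖ(α) = −Σ_{ℓ(λ)=k+2,|λ|=0} 𝔞_λ(τ_*α)/λ!` when `K_S α = 0` and
`e(S)α = 0` (all `α`, for an abelian surface). [cite: LiQinWang2002W, Thm. 4.6 p. 10]
[cite: LiQinWang2002, Def. 4.3, Lemma 4.6 and Thm. 4.10 (i) (pp. 9–10); Thm. 5.13 (v)] -/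
def IsVertexExpressible (𝔊 : ChernCharacterOperators hS H) : Prop :=
  ∀ (k s : ℕ) (γ : complexBetti S s) (l : List (ℤ × Σ i : ℕ, coeffFamily S i)), l.length = k + 1 →
    nestedBracket ℂ (coeffFamily S) 𝔊.q (𝔊.cupOperator k (ofDegree ℂ (ComplexPoints S) s γ)) s l =
      (-negModeProd (K := ℂ) l) •
        𝔊.q (modeSum l) (listProduct ℂ (coeffFamily S) (totalCup ℂ (ComplexPoints S))
          (ofDegree ℂ (ComplexPoints S) s γ) l)

/-- The case `k = 0` of vertex expressibility is the axiom `[𝔊₀(γ), 𝔮ₘ(β)] = m 𝔮ₘ(γβ)` (which holds for every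
surface). [cite: LiQinWang2002, Thm. 5.13 (iv) p. 13] -/
theorem isVertexExpressible_zero (𝔊 : ChernCharacterOperators hS H) (s : ℕ) (γ : complexBetti S s) (m : ℤ) (j : ℕ)
    (β : complexBetti S j) :
    nestedBracket ℂ (coeffFamily S) 𝔊.q (𝔊.cupOperator 0 (ofDegree ℂ (ComplexPoints S) s γ)) s [(m, ⟨j, β⟩)] =
      (-negModeProd (K := ℂ) [(m, (⟨j, β⟩ : Σ i : ℕ, coeffFamily S i))]) •
        𝔊.q (modeSum [(m, (⟨j, β⟩ : Σ i : ℕ, coeffFamily S i))])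
          (listProduct ℂ (coeffFamily S) (totalCup ℂ (ComplexPoints S)) (ofDegree ℂ (ComplexPoints S) s γ)
            [(m, ⟨j, β⟩)]) := by
  simp only [nestedBracket_cons, nestedBracket_nil, negModeProd, modeSum, listProduct, List.map_cons, List.map_nil,
    List.prod_cons, List.prod_nil, List.sum_cons, List.sum_nil, List.foldl_cons, List.foldl_nil, mul_one, add_zero,
    neg_neg]
  exact 𝔊.G_zero_bracket s γ m j β

end ChernCharacterOperators

/-! ### Named facts -/

/-- **Li–Qin–Wang / Lehn: the cup products of `H*(S^[n])` in Nakajima operators.**  For every smooth projective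
complex surface `S` and every choice `H` of its Hilbert schemes, Nakajima's operators together with the Chern
character classes `G_k(γ, n)` furnish an instance of `ChernCharacterOperators hS H`: ring generators (Thm. 1.2),
`𝔊₀(γ) = −𝔏₀(γ)` (Thm. 5.13 (iv); Lehn), `G₀(1, n) = n` (5.6), and Lehn's boundary relations (Thm. 3.10 / Prop. 3.12).
EXISTENTIAL INTERFACE RENDERING: implies `Nakajima1997_heisenberg_hilbertSchemes`.
[cite: LiQinWang2002, Thm. 1.2, Thm. 5.13 (iv), (5.6)–(5.7)] [cite: Lehn1999, Thm. 3.10 and Prop. 3.12] -/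
def LiQinWang2002_chernCharacterOperators : Prop :=
  ∀ ⦃S : SchemeOver ℂ⦄ (hS : IsSmoothProjective 2 S) (H : HilbertSchemesOfPoints S),
    Nonempty (ChernCharacterOperators hS H)

/-- **Li–Qin–Wang, IMRN 2002 Thm. 4.6, for abelian surfaces** (`K = 0`, `e = 0`, so `𝔄_X = H*(X)` and the Euler
term vanishes): for an abelian surface `A` and every choice `H` of its Hilbert schemes there is an instance of
`ChernCharacterOperators` all of whose `𝔊ₖ(γ)` are the vertex zero-modes `−W₀^{k+2}(γ)`
(`IsVertexExpressible`).  TODO(general form): `α ⊥ K_X` with the Euler-class term; Thm. 4.7.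
[cite: LiQinWang2002W, Thm. 4.6 p. 10] [cite: LiQinWang2002, Lemma 4.10 (i) and Thm. 5.13 (v)] -/
def LiQinWang2002W_chernCharacter_abelianSurface : Prop :=
  ∀ (A : AbelianVariety ℂ), A.dim = 2 → ∀ (hS : IsSmoothProjective 2 A.X) (H : HilbertSchemesOfPoints A.X),
    ∃ 𝔊 : ChernCharacterOperators hS H, 𝔊.IsVertexExpressible

/-- The cup-product fact implies the Nakajima–Grojnowski fact (forget the classes `G`). [cite: LiQinWang2002, Thm. 1.2] -/
theorem nakajima1997_of_liQinWang2002 (h : LiQinWang2002_chernCharacterOperators) :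
    Nakajima1997_heisenberg_hilbertSchemes :=
  fun _ hS H ↦ (h hS H).map ChernCharacterOperators.toNakajimaOperators

end Literature.AlgebraicGeometry.HilbertScheme

end
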